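import Mathlib
import HarnessLib
import Summits.RiemannHypothesis.RiemannHypothesis.Theorems.IntegerScrewParityGap

/-!
# Route `IntegerScrew` — the gap deficit of the truncated multiplicative walk is SHARP AT FIRST ORDER:
# `liminf_L L·(2 log 2 − Λ_{2}(L)) ≥ 2 log² 2 = δ^σ_{2}(∞)` (CONTINUUM-LIMIT 23.18 (a),(f), variational side)

With the centred 2-parity test function of `IntegerScrewParityGap.parity_test_function_of_le`, the Rayleigh
quotient is `2 log 2/L − (X(M) − O(1/H_M))/(L‖g‖²)` where `X(M) = Σ_{odd k ≤ M} r₂(⌊M/k⌋)/(2k)` is the blocked-birth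
term.  Here `X(M)` is evaluated to first order: on the dyadic band `M/2^{a+1} < k ≤ M/2^a` the defect is
`r₂ ≥ log 2/2^a` and the band's odd harmonic mass is `≥ ½(log 2 − 2^{a+2}/M)`, so `X(M) ≥ (log 2)²/2 − O(log M/M)`
(`parityX_ge_sharp`), whence (`walk_gap_le_sharp`, `M ≥ 64`) some `g ⊥_π 1`, `g ≠ 0` has
`E(g) ≤ (2 log 2/L − (2 log²2 − 2 log 2/L − 4 log 2(⌊log₂M⌋+2)/M)/(L(L+1)))·‖g‖²_π`, `L = log M`:
in `t`-units `Λ_{2}(L) ≤ 2 log 2 − (2 log²2 − o(1))/L`, the σ-model's first-order depth `δ^σ_{2}(∞) = 2 log²2 = 0.961`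
of the `{2}` atom (23.18 (a): measured `(2 log 2 − Λ_{2})·L = 0.946` at `L = 21.5`, `→ 0.961 − d_{2}/L`).

* `log_sub_log_le_sum_Icc_inv_succ`, `sum_inv_odd_Ioc_ge` — harmonic sums (over odd integers) on intervals;
* **`parityX_ge_sharp`** — `X(M) ≥ (log 2)²/2 − (log 2)(⌊log₂M⌋ + 2)/M`;
* `parity_test_function_sharp`, **`walk_gap_le_sharp`**.

RH-free.  References: PIVOT-LAW §13.10 (iv), CONTINUUM-LIMIT §23.18 (rh-explicit A6-PIVOT); M. Suzuki, J. Lond.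
Math. Soc. (2) 108 (2023) 1448–1487 [Suzuki2023].
-/

noncomputable section

set_option linter.dupNamespace false -- D-0017: `Summit.<S>.<S>.…` is the designed namespace

namespace Summit.RiemannHypothesis.RiemannHypothesis.Theorems.IntegerScrew

open Finset ArithmeticFunction

/-! ### Harmonic sums over odd integers on intervals -/

/-- `log(n+2) − log(m+1) ≤ Σ_{i=m}^{n} 1/(i+1)`. -/
theorem log_sub_log_le_sum_Icc_inv_succ (m n : ℕ) :
    Real.log ((n : ℝ) + 2) - Real.log ((m : ℝ) + 1) ≤ ∑ i ∈ Icc m n, 1 / ((i : ℝ) + 1) := by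
  induction n with
  | zero =>
    rcases Nat.eq_zero_or_pos m with rfl | hm
    · simp only [Finset.Icc_self, Finset.sum_singleton, CharP.cast_eq_zero, zero_add, Real.log_one, sub_zero]
      have := Real.log_two_lt_d9
      norm_num at this ⊢
      linarith
    · rw [Finset.Icc_eq_empty (by omega), Finset.sum_empty]
      have h2 : (2 : ℝ) ≤ (m : ℝ) + 1 := by exact_mod_cast (show 2 ≤ m + 1 by omega)
      simp only [CharP.cast_eq_zero, zero_add]
      linarith [Real.log_le_log (by norm_num) h2]
  | succ n ih =>
    by_cases hmn : m ≤ n + 1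
    · rw [Finset.sum_Icc_succ_top hmn]
      have hstep : Real.log ((n : ℝ) + 1 + 2) - Real.log ((n : ℝ) + 2) ≤ 1 / ((n : ℝ) + 1 + 1) := by
        rw [← Real.log_div (by positivity) (by positivity)]
        have h := Real.log_le_sub_one_of_pos (show (0 : ℝ) < ((n : ℝ) + 1 + 2) / ((n : ℝ) + 2) by positivity)
        have heq : ((n : ℝ) + 1 + 2) / ((n : ℝ) + 2) - 1 = 1 / ((n : ℝ) + 1 + 1) := by
          field_simp; ring
        linarith
      push_cast
      linarith
    · rw [Finset.Icc_eq_empty (by omega), Finset.sum_empty]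
      have h2 : (n : ℝ) + 1 + 2 ≤ (m : ℝ) + 1 := by exact_mod_cast (show n + 1 + 2 ≤ m + 1 by omega)
      push_cast
      linarith [Real.log_le_log (by positivity) h2]

/-- **Odd harmonic sum on an interval**: `Σ_{odd k ∈ (P, Q]} 1/k ≥ ½(log(Q+2) − log(P+3))` (`Q ≥ 1`), via the
odd numbers `2i+1`, `⌈P/2⌉ ≤ i ≤ ⌊(Q−1)/2⌋`, and `1/(2i+1) ≥ 1/(2i+2)`. -/
theorem sum_inv_odd_Ioc_ge (P : ℕ) {Q : ℕ} (hQ : 1 ≤ Q) :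
    (1 / 2) * (Real.log ((Q : ℝ) + 2) - Real.log ((P : ℝ) + 3)) ≤
      ∑ k ∈ (Ioc P Q).filter (fun k => Odd k), (1 : ℝ) / k := by
  set i₀ := (P + 1) / 2 with hi₀
  set i₁ := (Q - 1) / 2 with hi₁
  have hsub : (Icc i₀ i₁).image (fun i => 2 * i + 1) ⊆ (Ioc P Q).filter (fun k => Odd k) := by
    intro k hk
    obtain ⟨i, hi, rfl⟩ := Finset.mem_image.1 hk
    have hi := Finset.mem_Icc.1 hi
    simp only [Finset.mem_filter, Finset.mem_Ioc]
    exact ⟨⟨by omega, by omega⟩, ⟨i, rfl⟩⟩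
  have hinj : Set.InjOn (fun i => 2 * i + 1) ↑(Icc i₀ i₁) := by
    intro a _ b _ h; simp only at h; omega
  have h1 : ∑ i ∈ Icc i₀ i₁, (1 : ℝ) / ((2 * i + 1 : ℕ) : ℝ) ≤
      ∑ k ∈ (Ioc P Q).filter (fun k => Odd k), (1 : ℝ) / k := by
    calc ∑ i ∈ Icc i₀ i₁, (1 : ℝ) / ((2 * i + 1 : ℕ) : ℝ)
        = ∑ k ∈ (Icc i₀ i₁).image (fun i : ℕ => 2 * i + 1), (1 : ℝ) / (k : ℝ) := by rw [Finset.sum_image hinj]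
      _ ≤ _ := Finset.sum_le_sum_of_subset_of_nonneg hsub fun k _ _ => by positivity
  have h2 : ∑ i ∈ Icc i₀ i₁, (1 : ℝ) / (2 * ((i : ℝ) + 1)) ≤
      ∑ i ∈ Icc i₀ i₁, (1 : ℝ) / ((2 * i + 1 : ℕ) : ℝ) :=
    Finset.sum_le_sum fun i _ => by
      push_cast
      exact one_div_le_one_div_of_le (by positivity) (by linarith)
  have h3 : ∑ i ∈ Icc i₀ i₁, (1 : ℝ) / (2 * ((i : ℝ) + 1)) = (1 / 2) * ∑ i ∈ Icc i₀ i₁, 1 / ((i : ℝ) + 1) := by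
    rw [Finset.mul_sum]
    refine Finset.sum_congr rfl fun i _ => ?_
    have : (0 : ℝ) < (i : ℝ) + 1 := by positivity
    field_simp
  have h4 := log_sub_log_le_sum_Icc_inv_succ i₀ i₁
  have h5 : ((Q : ℝ) + 2) / 2 ≤ (i₁ : ℝ) + 2 := by
    have : Q + 2 ≤ 2 * i₁ + 4 := by omega
    have h : (Q : ℝ) + 2 ≤ 2 * (i₁ : ℝ) + 4 := by exact_mod_cast this
    linarith
  have h6 : (i₀ : ℝ) + 1 ≤ ((P : ℝ) + 3) / 2 := by
    have : 2 * i₀ + 2 ≤ P + 3 := by omega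
    have h : 2 * (i₀ : ℝ) + 2 ≤ (P : ℝ) + 3 := by exact_mod_cast this
    linarith
  have h7 : Real.log ((Q : ℝ) + 2) - Real.log ((P : ℝ) + 3) ≤
      Real.log ((i₁ : ℝ) + 2) - Real.log ((i₀ : ℝ) + 1) := by
    have a1 : Real.log (((Q : ℝ) + 2) / 2) ≤ Real.log ((i₁ : ℝ) + 2) := Real.log_le_log (by positivity) h5
    have a2 : Real.log ((i₀ : ℝ) + 1) ≤ Real.log (((P : ℝ) + 3) / 2) := Real.log_le_log (by positivity) h6
    rw [Real.log_div (by positivity) (by norm_num)] at a1 a2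
    linarith
  calc (1 / 2) * (Real.log ((Q : ℝ) + 2) - Real.log ((P : ℝ) + 3))
      ≤ (1 / 2) * ∑ i ∈ Icc i₀ i₁, 1 / ((i : ℝ) + 1) :=
        mul_le_mul_of_nonneg_left (h7.trans h4) (by norm_num)
    _ ≤ _ := by rw [← h3]; exact h2.trans h1

/-- **Sharp lower bound for the blocked-birth term**: `X(M) ≥ (log 2)²/2 − (log 2)(⌊log₂M⌋ + 2)/M`.  On the
dyadic band `M/2^{a+1} < k ≤ M/2^a` the defect is `r₂(⌊M/k⌋) ≥ log 2/2^a` EXACTLY at the dyadic scale (only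
`2, 4, …, 2^a ≤ ⌊M/k⌋` are blocked from contributing), and the band carries odd harmonic mass `≥ ½(log 2 − 2^{a+2}/M)`;
summing the geometric series gives `(log 2)²/2` — the value behind the first-order coefficient `2 log²2` below. -/
theorem parityX_ge_sharp {M : ℕ} (hM : 1 ≤ M) :
    Real.log 2 ^ 2 / 2 - Real.log 2 * ((Nat.log 2 M : ℝ) + 2) / M ≤
      ∑ k ∈ Icc 1 M, parityFun 2 k / (k : ℝ) * (if 2 ∣ k then 0 else
        (Real.log 2 / ((2 : ℝ) - 1) - ∑ n ∈ (Icc 1 (M / k)).filter (fun n => 2 ∣ n), (Λ n : ℝ) / n)) := by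
  have hM0 : (0 : ℝ) < M := by exact_mod_cast hM
  have hlog2 : 0 < Real.log 2 := Real.log_pos one_lt_two
  set A := Nat.log 2 M with hA
  set F : ℕ → ℝ := fun k => parityFun 2 k / (k : ℝ) * (if 2 ∣ k then 0 else
    (Real.log 2 / ((2 : ℝ) - 1) - ∑ n ∈ (Icc 1 (M / k)).filter (fun n => 2 ∣ n), (Λ n : ℝ) / n)) with hF
  -- pointwise: on odd k, F k ≥ (log 2/2^{a(k)+1})/k with a(k) = ⌊log₂⌊M/k⌋⌋; on even k, F k = 0
  have hF_odd : ∀ k, 1 ≤ k → ¬ 2 ∣ k → Real.log 2 / 2 ^ (Nat.log 2 (M / k) + 1) * (1 / (k : ℝ)) ≤ F k := by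
    intro k hk1 h2
    rw [hF]; dsimp only
    rw [if_neg h2, parityFun_of_not_dvd h2]
    have hsharp := sum_Icc_dvd_vonMangoldt_div_le_sharp Nat.prime_two (M / k)
    have hr : Real.log 2 / 2 ^ Nat.log 2 (M / k) ≤ Real.log 2 / ((2 : ℝ) - 1) -
        ∑ n ∈ (Icc 1 (M / k)).filter (fun n => 2 ∣ n), (Λ n : ℝ) / n := by
      norm_num at hsharp
      rw [show ((2 : ℝ) - 1) = 1 by norm_num, div_one]
      have e : Real.log 2 / 2 ^ Nat.log 2 (M / k) =
          Real.log 2 - Real.log 2 * (1 - ((2 : ℝ) ^ Nat.log 2 (M / k))⁻¹) := by ring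
      linarith
    have hk0 : (0 : ℝ) < k := by exact_mod_cast hk1
    calc Real.log 2 / 2 ^ (Nat.log 2 (M / k) + 1) * (1 / (k : ℝ))
        = (2 : ℝ)⁻¹ / k * (Real.log 2 / 2 ^ Nat.log 2 (M / k)) := by rw [pow_succ]; field_simp
      _ ≤ (2 : ℝ)⁻¹ / k * _ := mul_le_mul_of_nonneg_left hr (by positivity)
  have hF_nonneg : ∀ k, 1 ≤ k → 0 ≤ F k := by
    intro k hk1
    by_cases h2 : 2 ∣ k
    · rw [hF]; dsimp only; rw [if_pos h2, mul_zero]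
    · exact le_trans (by positivity) (hF_odd k hk1 h2)
  -- fiberwise over the dyadic scale a = ⌊log₂⌊M/k⌋⌋ ∈ {0, …, A}
  have hmaps : ∀ k ∈ Icc 1 M, Nat.log 2 (M / k) ∈ Finset.range (A + 1) := by
    intro k _
    rw [Finset.mem_range, Nat.lt_succ_iff, hA]
    exact Nat.log_mono_right (Nat.div_le_self M k)
  rw [← Finset.sum_fiberwise_of_maps_to hmaps]
  -- per band
  have hband : ∀ a ∈ Finset.range (A + 1), Real.log 2 ^ 2 / 2 ^ (a + 2) - Real.log 2 / M ≤
      ∑ k ∈ (Icc 1 M).filter (fun k => Nat.log 2 (M / k) = a), F k := by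
    intro a ha
    have haA : a ≤ A := Nat.lt_succ_iff.1 (Finset.mem_range.1 ha)
    set Q := M / 2 ^ a with hQ
    set P := M / 2 ^ (a + 1) with hP
    have h2a : 0 < 2 ^ a := Nat.two_pow_pos a
    have hQ1 : 1 ≤ Q := by
      rw [hQ, Nat.le_div_iff_mul_le h2a, one_mul]
      calc 2 ^ a ≤ 2 ^ A := Nat.pow_le_pow_right (by norm_num) haA
        _ ≤ M := by rw [hA]; exact Nat.pow_log_le_self 2 (by omega)
    have hPQ : 2 * P ≤ Q := by
      rw [hP, hQ, pow_succ, ← Nat.div_div_eq_div_mul]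
      omega
    -- the odd k ∈ (P, Q] lie in the band-a fiber
    have hsub : (Ioc P Q).filter (fun k => Odd k) ⊆ (Icc 1 M).filter (fun k => Nat.log 2 (M / k) = a) := by
      intro k hk
      rw [Finset.mem_filter, Finset.mem_Ioc] at hk
      obtain ⟨⟨hPk, hkQ⟩, -⟩ := hk
      have hk1 : 1 ≤ k := by omega
      have hkM : k ≤ M := hkQ.trans (Nat.div_le_self _ _)
      rw [Finset.mem_filter, Finset.mem_Icc]
      refine ⟨⟨hk1, hkM⟩, Nat.log_eq_of_pow_le_of_lt_pow ?_ ?_⟩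
      · rw [Nat.le_div_iff_mul_le (by omega)]
        rw [hQ, Nat.le_div_iff_mul_le h2a] at hkQ
        rwa [mul_comm] at hkQ
      · rw [Nat.div_lt_iff_lt_mul (by omega)]
        rw [hP, Nat.div_lt_iff_lt_mul (Nat.two_pow_pos _)] at hPk
        rwa [mul_comm] at hPk
    -- the band's odd harmonic mass: log(Q+2) − log(P+3) ≥ log 2 − 2^{a+2}/M
    have hQ2 : (M : ℝ) ≤ ((Q : ℝ) + 2) * 2 ^ a := by
      have h := Nat.lt_div_mul_add (a := M) h2a
      rw [← hQ] at h
      have h' : (M : ℝ) < (Q : ℝ) * 2 ^ a + 2 ^ a := by exact_mod_cast h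
      have e : ((Q : ℝ) + 2) * 2 ^ a = (Q : ℝ) * 2 ^ a + 2 ^ a + 2 ^ a := by ring
      rw [e]
      linarith [pow_pos (two_pos : (0 : ℝ) < 2) a]
    have hP3 : (P : ℝ) + 3 ≤ ((Q : ℝ) + 6) / 2 := by
      have : 2 * P + 6 ≤ Q + 6 := by omega
      have h : 2 * (P : ℝ) + 6 ≤ (Q : ℝ) + 6 := by exact_mod_cast this
      linarith
    have hl1 : Real.log ((P : ℝ) + 3) ≤ Real.log ((Q : ℝ) + 6) - Real.log 2 := by
      rw [← Real.log_div (by positivity) (by norm_num)]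
      exact Real.log_le_log (by positivity) hP3
    have hl3 : Real.log ((Q : ℝ) + 6) - Real.log ((Q : ℝ) + 2) ≤ 4 / ((Q : ℝ) + 2) := by
      rw [← Real.log_div (by positivity) (by positivity)]
      have h := Real.log_le_sub_one_of_pos (show (0 : ℝ) < ((Q : ℝ) + 6) / ((Q : ℝ) + 2) by positivity)
      have heq : ((Q : ℝ) + 6) / ((Q : ℝ) + 2) - 1 = 4 / ((Q : ℝ) + 2) := by field_simp; ring
      linarith
    have hl4 : 4 / ((Q : ℝ) + 2) ≤ 2 ^ (a + 2) / (M : ℝ) := by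
      rw [div_le_div_iff₀ (by positivity) hM0, pow_add]
      nlinarith [hQ2]
    have hlog : Real.log 2 - 2 ^ (a + 2) / (M : ℝ) ≤ Real.log ((Q : ℝ) + 2) - Real.log ((P : ℝ) + 3) := by
      linarith
    calc Real.log 2 ^ 2 / 2 ^ (a + 2) - Real.log 2 / M
        = Real.log 2 / 2 ^ (a + 1) * ((1 / 2) * (Real.log 2 - 2 ^ (a + 2) / (M : ℝ))) := by
          rw [pow_succ, pow_succ, pow_succ]; field_simp
      _ ≤ Real.log 2 / 2 ^ (a + 1) * ((1 / 2) * (Real.log ((Q : ℝ) + 2) - Real.log ((P : ℝ) + 3))) :=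
          mul_le_mul_of_nonneg_left (mul_le_mul_of_nonneg_left hlog (by norm_num)) (by positivity)
      _ ≤ Real.log 2 / 2 ^ (a + 1) * ∑ k ∈ (Ioc P Q).filter (fun k => Odd k), (1 : ℝ) / k :=
          mul_le_mul_of_nonneg_left (sum_inv_odd_Ioc_ge P hQ1) (by positivity)
      _ = ∑ k ∈ (Ioc P Q).filter (fun k => Odd k), Real.log 2 / 2 ^ (a + 1) * (1 / (k : ℝ)) := by
          rw [Finset.mul_sum]
      _ ≤ ∑ k ∈ (Ioc P Q).filter (fun k => Odd k), F k := Finset.sum_le_sum fun k hk => by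
          have hk' := Finset.mem_filter.1 (hsub hk)
          have hko := (Finset.mem_filter.1 hk).2
          have h2 : ¬ 2 ∣ k := Nat.two_dvd_ne_zero.2 (Nat.odd_iff.1 hko)
          have h := hF_odd k (Finset.mem_Icc.1 hk'.1).1 h2
          rwa [hk'.2] at h
      _ ≤ ∑ k ∈ (Icc 1 M).filter (fun k => Nat.log 2 (M / k) = a), F k :=
          Finset.sum_le_sum_of_subset_of_nonneg hsub fun k hk _ =>
            hF_nonneg k (Finset.mem_Icc.1 (Finset.mem_filter.1 hk).1).1
  refine le_trans ?_ (Finset.sum_le_sum hband)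
  rw [Finset.sum_sub_distrib, Finset.sum_const, Finset.card_range, nsmul_eq_mul]
  -- the geometric series: Σ_{a ≤ A} log²2/2^{a+2} = log²2/2 − log²2/2^{A+2} ≥ log²2/2 − log 2/M (as 2^{A+1} > M)
  have hgeom : ∑ a ∈ Finset.range (A + 1), Real.log 2 ^ 2 / (2 : ℝ) ^ (a + 2) =
      Real.log 2 ^ 2 / 2 - Real.log 2 ^ 2 / 2 ^ (A + 2) := by
    have hg : ∀ n : ℕ, ∑ a ∈ Finset.range (n + 1), Real.log 2 ^ 2 / (2 : ℝ) ^ (a + 2) =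
        Real.log 2 ^ 2 / 2 - Real.log 2 ^ 2 / 2 ^ (n + 2) := by
      intro n
      induction n with
      | zero => simp only [zero_add, Finset.range_one, Finset.sum_singleton]; ring
      | succ n ih =>
        rw [Finset.sum_range_succ, ih, show n + 1 + 2 = n + 2 + 1 by ring, pow_succ (2 : ℝ) (n + 2)]
        field_simp
        ring
    exact hg A
  have hA2 : Real.log 2 ^ 2 / 2 ^ (A + 2) ≤ Real.log 2 / M := by
    have hM2 : (M : ℝ) < 2 ^ (A + 1) := by
      have := Nat.lt_pow_succ_log_self one_lt_two M
      rw [← hA] at this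
      exact_mod_cast this
    rw [div_le_div_iff₀ (by positivity) hM0]
    have hl : Real.log 2 < 1 := by linarith [Real.log_two_lt_d9]
    have e : Real.log 2 * (2 : ℝ) ^ (A + 2) = 2 * (Real.log 2 * 2 ^ (A + 1)) := by rw [pow_succ]; ring
    rw [e]
    have h1 : Real.log 2 ^ 2 * (M : ℝ) ≤ Real.log 2 * M := by
      have h := mul_le_mul_of_nonneg_right hl.le (mul_pos hlog2 hM0).le
      calc Real.log 2 ^ 2 * (M : ℝ) = Real.log 2 * (Real.log 2 * M) := by ring
        _ ≤ 1 * (Real.log 2 * M) := h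
        _ = Real.log 2 * M := one_mul _
    have h2 : Real.log 2 * (M : ℝ) ≤ Real.log 2 * 2 ^ (A + 1) := mul_le_mul_of_nonneg_left hM2.le hlog2.le
    nlinarith [mul_pos hlog2 (pow_pos (two_pos : (0 : ℝ) < 2) (A + 1))]
  rw [hgeom]
  have e : Real.log 2 * ((Nat.log 2 M : ℝ) + 2) / M = (((A + 1 : ℕ) : ℝ)) * (Real.log 2 / M) + Real.log 2 / M := by
    rw [hA]; push_cast; ring
  rw [e]
  linarith

/-- **The sharp test function**: `parity_test_function_of_le` with `B = (log 2)²/2 − (log 2)(⌊log₂M⌋+2)/M`. -/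
theorem parity_test_function_sharp {M : ℕ} (hM : 2 ≤ M) :
    ∃ g : St M → ℝ, (∑ k : St M, g k / (k : ℕ) = 0) ∧ (∃ k : St M, g k ≠ 0) ∧
      (∑ k : St M, g k ^ 2 / (k : ℕ) ≤ (∑ k : St M, (1 : ℝ) / (k : ℕ)) / 4) ∧
      -(∑ k : St M, g k / (k : ℕ) * ∑ j : St M, walkGen M k j * g j) ≤
        (2 * Real.log 2 / Real.log M) * ∑ k : St M, g k ^ 2 / (k : ℕ) -
          (1 / Real.log M) * (Real.log 2 ^ 2 / 2 - Real.log 2 * ((Nat.log 2 M : ℝ) + 2) / M -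
            Real.log 2 / (2 * ∑ k : St M, (1 : ℝ) / (k : ℕ))) :=
  parity_test_function_of_le hM (parityX_ge_sharp (by omega))

/-- **First-order SHARP gap deficit** (`M ≥ 64`): some `g ⊥_π 1`, `g ≠ 0` has Rayleigh quotient
`≤ 2 log 2/L − (2 log²2 − 2 log 2/L − 4 log 2(⌊log₂M⌋+2)/M)/(L(L+1))`, `L = log M`.  In `t`-units:
`Λ_{2}(L) ≤ 2 log 2 − (2 log² 2 − O(1/L))/(L+1)`, i.e. `liminf_L L·(2 log 2 − Λ_{2}(L)) ≥ 2 log² 2 = 0.961 =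
δ^σ_{2}(∞)` — the first-order (σ-model) depth of the `{2}` atom of CONTINUUM-LIMIT 23.18 (a),(f), attained from
one side by the variational principle (WALK-LADDER §7: `(2 log 2 − Λ_{2})·L = 0.946` at `L = 21.5`; 23.18 (a):
`→ 0.961 − d_{2}/L`). -/
theorem walk_gap_le_sharp {M : ℕ} (hM : 64 ≤ M) :
    ∃ g : St M → ℝ, (∑ k : St M, g k / (k : ℕ) = 0) ∧ (∃ k : St M, g k ≠ 0) ∧
      -(∑ k : St M, g k / (k : ℕ) * ∑ j : St M, walkGen M k j * g j) ≤
        (2 * Real.log 2 / Real.log M -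
          (2 * Real.log 2 ^ 2 - 2 * Real.log 2 / Real.log M - 4 * Real.log 2 * ((Nat.log 2 M : ℝ) + 2) / M) /
            (Real.log M * (Real.log M + 1))) * ∑ k : St M, g k ^ 2 / (k : ℕ) := by
  obtain ⟨g, h0, hne, hV, hE⟩ := parity_test_function_sharp (M := M) (by omega)
  refine ⟨g, h0, hne, hE.trans ?_⟩
  have hlog2 : 0 < Real.log 2 := Real.log_pos one_lt_two
  have hM0 : (0 : ℝ) < M := by exact_mod_cast (show 0 < M by omega)
  set L : ℝ := Real.log M with hLdef
  set H : ℝ := ∑ k : St M, (1 : ℝ) / (k : ℕ) with hHdef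
  set W : ℝ := ∑ k : St M, g k ^ 2 / (k : ℕ) with hW
  set u : ℝ := Real.log 2 * ((Nat.log 2 M : ℝ) + 2) / M with hu
  -- L ≥ 6 log 2, L ≤ H ≤ L + 1
  have hL6 : 6 * Real.log 2 ≤ L := by
    rw [hLdef, ← Real.log_rpow two_pos, show ((2 : ℝ) ^ (6 : ℝ)) = 64 by norm_num]
    exact Real.log_le_log (by norm_num) (by exact_mod_cast hM)
  have hL : 0 < L := by linarith
  have hHI : ∑ m ∈ Icc 1 M, (1 : ℝ) / m = H := by
    rw [hHdef, Finset.sum_coe_sort (Finset.Icc 1 M) (fun k => (1 : ℝ) / k)]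
  have hLH : L ≤ H := by
    have h := log_succ_le_harmonicSum M
    rw [hHI] at h
    exact le_trans (Real.log_le_log hM0 (by linarith)) h
  have hHle : H ≤ L + 1 := by rw [← hHI]; exact harmonicSum_le_log_add_one (by omega)
  have hW0 : 0 ≤ W := Finset.sum_nonneg fun k _ => by positivity
  have hWle : W ≤ (L + 1) / 4 := hV.trans (by linarith)
  -- u ≤ log 2/8 : 8(⌊log₂M⌋ + 2) ≤ M for M ≥ 64
  have hu8 : u ≤ Real.log 2 / 8 := by
    have hj : 8 * (Nat.log 2 M + 2) ≤ M := by
      have hj6 : 6 ≤ Nat.log 2 M := by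
        have h := Nat.log_mono_right (b := 2) hM
        rwa [show (64 : ℕ) = 2 ^ 6 by norm_num, Nat.log_pow one_lt_two] at h
      have key : ∀ j : ℕ, 6 ≤ j → 8 * (j + 2) ≤ 2 ^ j := by
        intro j hj
        induction j, hj using Nat.le_induction with
        | base => norm_num
        | succ j hj ih =>
          have : 8 ≤ 2 ^ j := le_trans (by norm_num) (Nat.pow_le_pow_right (by norm_num) hj)
          rw [pow_succ]; omega
      exact (key _ hj6).trans (Nat.pow_log_le_self 2 (by omega))
    have hj' : (8 : ℝ) * ((Nat.log 2 M : ℝ) + 2) ≤ M := by exact_mod_cast hj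
    rw [hu, div_le_div_iff₀ hM0 (by norm_num)]
    nlinarith
  -- the deficit D = log²2/2 − u − log 2/(2L) is ≥ 0 and ≤ the test function's deficit
  set D : ℝ := Real.log 2 ^ 2 / 2 - u - Real.log 2 / (2 * L) with hD
  have hD0 : 0 ≤ D := by
    have h1 : Real.log 2 / (2 * L) ≤ 1 / 12 := by
      rw [div_le_div_iff₀ (by positivity) (by norm_num)]; linarith
    have h2 := Real.log_two_gt_d9
    rw [hD]; nlinarith
  have hDle : D ≤ Real.log 2 ^ 2 / 2 - u - Real.log 2 / (2 * H) := by
    have : Real.log 2 / (2 * H) ≤ Real.log 2 / (2 * L) :=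
      div_le_div_of_nonneg_left hlog2.le (by positivity) (by linarith)
    rw [hD]; linarith
  -- (1/L)·D ≥ (D/L)·(4W/(L+1)) = (4D/(L(L+1)))·W
  have key : (2 * Real.log 2 ^ 2 - 2 * Real.log 2 / L - 4 * u) / (L * (L + 1)) * W ≤ (1 / L) * D := by
    have e : (2 * Real.log 2 ^ 2 - 2 * Real.log 2 / L - 4 * u) = 4 * D := by rw [hD]; ring
    rw [e]
    calc 4 * D / (L * (L + 1)) * W ≤ 4 * D / (L * (L + 1)) * ((L + 1) / 4) :=
          mul_le_mul_of_nonneg_left hWle (by positivity)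
      _ = (1 / L) * D := by field_simp
  have e2 : 4 * Real.log 2 * ((Nat.log 2 M : ℝ) + 2) / M = 4 * u := by rw [hu]; ring
  rw [e2, sub_mul]
  have h3 : (1 / L) * D ≤ (1 / L) * (Real.log 2 ^ 2 / 2 - u - Real.log 2 / (2 * H)) :=
    mul_le_mul_of_nonneg_left hDle (by positivity)
  linarith

end Summit.RiemannHypothesis.RiemannHypothesis.Theorems.IntegerScrew

end
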